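import Literature.Probability.RandomPlanarGeometry.HexSAWRotTriangleIdentity
import HarnessLib

/-!
# Beaton's rotated triangle: side classes, block windows, the face of the rotated Glazman–Manolescu tour, and the frame of the tour

Topic `Literature/Probability/RandomPlanarGeometry`; lane «pcv-sawmu», door R95 «HEX-BW-GM-ROT» (planner a-idea-1,
typed layer `Sketch_G16_K954.lean` e4e31e90a0589e7a, rebased editions G17d/G17e; tree edition split by prover a-p6 g7,
statements token-identical to the HOME kernel text G17e 1637ea746fc4e499 unless said in the file header).
Sources: A. Glazman, I. Manolescu, *Self-avoiding walk on ℤ² with Yang–Baxter weights: universality of critical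
fugacity and 2-point function* (arXiv:1708.00395; AIHP 2020), §4.1, Lemma 4.1 and Proposition 1.1 (the three
rotated triangles and the block inequality); N. R. Beaton, *The critical surface fugacity of self-avoiding walks on a
rotated honeycomb lattice*, J. Phys. A 47 (2014) 075003 (arXiv:1210.0274v3), §2.2, Proposition 4, Appendix Thm 14.

SECTION 1 (Part D of the HOME text: the interior of face K95.4 except the tour itself): the side classes of Beaton's
rotated triangle `T_M` regrouped by SIDE (`IsRotSideL/R`, masses `rotSideL/R = α_M/β_M`, junction mass
`rotChi = m_M = max(α_M, β_M)`), the chirality bound **K95.4c** `rotTriW_le_chi : W_M ≤ 2c_B · m_M`; the distance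
WINDOWS of the ratio-20 blocks (`IsRotBotWin`, `rotBotWin`) with the bookkeeping **K95.4b** `rotBotWin_sum_le` and the
total bottom mass bound `rotBot_le_K` (from the tree's strip identity `HV.rotStrip_identity`, Beaton Prop. 4). The FACE
**K95.4a** `RotTourKeyIneq`, the face **K95.4** `RotTriBlockIneq` and the derivation `rotTriBlockIneq_of_tour` live with their
proofs in `HexSAWRotTourKeyIneq.lean` (no unproved `Prop` is introduced in this file).

SECTION 2 (Part E = T1 of the HOME text): the FRAME of the tour — the rotation `rotC0 M` by `π/3` about the corner
`c₀ = (X, h) = (-6M, 0)` of `T_M` (the tree's `rot60` conjugated by a translation), the slide `slideL` along `ℓ`,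
the placements `rotPhi2`/`rotPhi3` of pieces 2 and 3 and their action on Beaton's coordinates `(X, -ξ)`, the junction
vertices (images of `a∓` = the endpoints of ray-edge `k`), the three open `60°`-sectors at `c₀` and the containment
lemmas (T3), the mirror `reflX : X ↦ 6 - X`, uniqueness of vertices by coordinates and the cocycle
`Φ₂(M,k) ∘ Φ₂(k,k') = Φ₃(M,k')`; kernel sanity at `M = 1` (two whole-tour instances `tourEx1/2` of the sixteen in HOME).

Integer model (Part B): a vertex `v` sits at `(X, h) = (xX v, -xi v)`, plane position `(X/2, h√3/2)`
in edge units; hexagon centres are the points with `X - 3h ≡ 0 (mod 6)`; `T_M` = `{h ≥ 1, h - 6M < X <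
6M + 6 - h} ∪ {a⁻, a⁺}` has base corners `c₀ = (-6M, 0)`, `c₁ = (6M+6, 0)` and apex `(3, 6M+3)`.
The rotation by `+π/3` about `c₀` acts on `(P, h) := (X + 6M, h)` by `(P, h) ↦ ((P - 3h)/2, (P + h)/2)`.
-/

noncomputable section

open Finset Filter Topology
open scoped BigOperators


/-! ## Section: HexSAWRotTriangleJunction -/

namespace Literature.Probability.RandomPlanarGeometry.SAW.HV

/-- One of Beaton's coefficient inequalities for `2sin(π/16), 2sin(3π/16), 2cos(π/16), 2cos(3π/16), 2cos(7π/16)` (elementary trigonometry). [cite: Beaton2014RotatedHoneycomb, Proposition 4 (the coefficients)] -/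
private theorem cO_pos : 0 < 2 * Real.sin (3 * Real.pi / 16) := by
  have := Real.sin_pos_of_pos_of_lt_pi (x := 3 * Real.pi / 16) (by positivity) (by linarith [Real.pi_pos])
  linarith
/-- One of Beaton's coefficient inequalities for `2sin(π/16), 2sin(3π/16), 2cos(π/16), 2cos(3π/16), 2cos(7π/16)` (elementary trigonometry). [cite: Beaton2014RotatedHoneycomb, Proposition 4 (the coefficients)] -/
private theorem cI_pos : 0 < 2 * Real.sin (Real.pi / 16) := by
  have := Real.sin_pos_of_pos_of_lt_pi (x := Real.pi / 16) (by positivity) (by linarith [Real.pi_pos])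
  linarith
/-- One of Beaton's coefficient inequalities for `2sin(π/16), 2sin(3π/16), 2cos(π/16), 2cos(3π/16), 2cos(7π/16)` (elementary trigonometry). [cite: Beaton2014RotatedHoneycomb, Proposition 4 (the coefficients)] -/
private theorem cE_pos : 0 < 2 * Real.cos (3 * Real.pi / 16) := by
  have := Real.cos_pos_of_mem_Ioo (x := 3 * Real.pi / 16) ⟨by linarith [Real.pi_pos], by linarith [Real.pi_pos]⟩
  linarith
/-- One of Beaton's coefficient inequalities for `2sin(π/16), 2sin(3π/16), 2cos(π/16), 2cos(3π/16), 2cos(7π/16)` (elementary trigonometry). [cite: Beaton2014RotatedHoneycomb, Proposition 4 (the coefficients)] -/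
private theorem cB_pos : 0 < 2 * Real.cos (Real.pi / 16) := by
  have := Real.cos_pos_of_mem_Ioo (x := Real.pi / 16) ⟨by linarith [Real.pi_pos], by linarith [Real.pi_pos]⟩
  linarith
/-- One of Beaton's coefficient inequalities for `2sin(π/16), 2sin(3π/16), 2cos(π/16), 2cos(3π/16), 2cos(7π/16)` (elementary trigonometry). [cite: Beaton2014RotatedHoneycomb, Proposition 4 (the coefficients)] -/
private theorem cB_ge_one : 1 ≤ 2 * Real.cos (Real.pi / 16) := by
  have h := Real.cos_le_cos_of_nonneg_of_le_pi (x := Real.pi / 16) (y := Real.pi / 3)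
    (by positivity) (by linarith [Real.pi_pos]) (by linarith [Real.pi_pos])
  rw [Real.cos_pi_div_three] at h
  linarith
/- ERRATUM E-G15-2 (edition G16; a-p2 g6's refutation of record 01:32:43Z, lead r91, lit-1 01:33:27Z):
the close-class coefficient on `rotGF V IsRotCloseDart` is `c_P · x_c / 2 = 2 cos(7π/16)`, NOT `c_P/2 =
2 x_c⁻¹ cos(7π/16)` — Beaton's `P_{T,L}` counts polygons by occupied vertices INCLUDING `a⁻` [§2.1–§2.2],
while `rotGF` (weight `x_c^{mwLen}`) omits `a⁻`, whence the factor `x_c` (`c_tri.py`'s `P` = `x_c · rotGF(close)`).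
With the G15 token the real forms failed on finite data by +1.5e−2 … +2.3e−2 (D(2,1)…D(4,1), T_1, T_2); with
the repair they hold to ≤ 1.3e−12 (a-p2 `r95/check/` 6ac6cc8a / 7f8efeb3 / 3662c98d / 4b003bd8). -/
/-- One of Beaton's coefficient inequalities for `2sin(π/16), 2sin(3π/16), 2cos(π/16), 2cos(3π/16), 2cos(7π/16)` (elementary trigonometry). [cite: Beaton2014RotatedHoneycomb, Proposition 4 (the coefficients)] -/
private theorem cP_pos : 0 < 2 * Real.cos (7 * Real.pi / 16) := by
  have := Real.cos_pos_of_mem_Ioo (x := 7 * Real.pi / 16) ⟨by linarith [Real.pi_pos], by linarith [Real.pi_pos]⟩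
  linarith

/-- `0 ≤ W_M` (both coefficients and both class generating functions are nonnegative). [cite: Beaton2014RotatedHoneycomb, Proposition 4; GlazmanManolescu2019, §4.1] -/
theorem rotTriW_nonneg (M : ℕ) : 0 ≤ rotTriW M :=
  add_nonneg (mul_nonneg cE_pos.le (rotGF_nonneg _ _)) (mul_nonneg cB_pos.le (rotGF_nonneg _ _))

/-! #### K95.4c — side exits regrouped by SIDE instead of by edge type; the junction mass `m_M` -/

/-- darts onto the LEFT side line `X = -6M - ξ` of `T_M` (toward the corner `c₀`; Beaton headings
180°/120°). `IsRotSideDart M d ↔ IsRotSideL M d ∨ IsRotSideR M d` by `Iff.rfl`. [cite: GlazmanManolescu2019, §4.1] -/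
def IsRotSideL (M : ℕ) (d : HV × HV) : Prop := xX d.2 = -(6 : ℤ) * M - xi d.2
/-- darts onto the RIGHT side line `X = 6M + 6 + ξ` of `T_M`. [cite: GlazmanManolescu2019, §4.1] -/
def IsRotSideR (M : ℕ) (d : HV × HV) : Prop := xX d.2 = 6 * M + 6 + xi d.2

/-- Decidability of the left-line class (the generating functions are `Finset.filter` sums). [folklore] -/
instance (M : ℕ) : DecidablePred (IsRotSideL M) := fun d => by unfold IsRotSideL; infer_instance
/-- Decidability of the right-line class. [folklore] -/
instance (M : ℕ) : DecidablePred (IsRotSideR M) := fun d => by unfold IsRotSideR; infer_instance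

/-- A side dart is a left-line dart or a right-line dart (by definition). [cite: GlazmanManolescu2019, §4.1] -/
theorem isRotSideDart_iff (M : ℕ) (d : HV × HV) : IsRotSideDart M d ↔ IsRotSideL M d ∨ IsRotSideR M d :=
  Iff.rfl

/-- kernel sanity (edition G16, erratum E-G15-1): the one-step walk `a → a⁺ → (-1,0,true)` of `T_0` is a
`β`-type exit through the right side (`β_0 = x_c` of ROUTES-G15 §2.3 S4). [folklore] -/
example : IsRotSideR 0 (hvOrigin, ((-1 : ℤ), (0 : ℤ), true)) ∧
    IsRotSideBeta 0 (hvOrigin, ((-1 : ℤ), (0 : ℤ), true)) := by decide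

/-- `α_M` := the right-started LEFT-exit mass of `T_M` (`ctri_tm.py chi (M+1)`: `alpha(+,L)`).
[cite: GlazmanManolescu2019, §4.1] -/
def rotSideL (M : ℕ) : ℝ := rotGF ((rotTriV M).erase wOut) (IsRotSideL M)
/-- `β_M` := the right-started RIGHT-exit mass of `T_M`; by the reflection `X ↦ 6 - X` (swapping `a∓`,
fixing `T_M`) it equals the LEFT-started left-exit mass (`ctri_tm.py chi (M+1)`: `(+,R) = beta(-,L)`).
[cite: GlazmanManolescu2019, §4.1] -/
def rotSideR (M : ℕ) : ℝ := rotGF ((rotTriV M).erase wOut) (IsRotSideR M)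
/-- the JUNCTION MASS `m_M := max(α_M, β_M)`: at a ray-edge junction BOTH start classes of the next piece
are available (ROUTES-G15 §2.3 S4, the ray-edge shuffle), so the tour uses the heavier one; for piece 1
it is the choice of the corner (`c₀` for left exits, `c₁` for right exits). [cite: GlazmanManolescu2019, Lemma 4.1] -/
def rotChi (M : ℕ) : ℝ := max (rotSideL M) (rotSideR M)

/-- `0 ≤ α_M`. [cite: GlazmanManolescu2019, §4.1] -/
theorem rotSideL_nonneg (M : ℕ) : 0 ≤ rotSideL M := rotGF_nonneg _ _
/-- `0 ≤ β_M`. [cite: GlazmanManolescu2019, §4.1] -/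
theorem rotSideR_nonneg (M : ℕ) : 0 ≤ rotSideR M := rotGF_nonneg _ _
/-- `0 ≤ m_M`. [cite: GlazmanManolescu2019, Lemma 4.1] -/
theorem rotChi_nonneg (M : ℕ) : 0 ≤ rotChi M := (rotSideL_nonneg M).trans (le_max_left _ _)

/-- Regrouping: `ε`-type + `β`-type side mass ≤ left + right side mass (every side dart lies on the left
or on the right line by definition; the two edge types are disjoint). Pure bookkeeping over one finite
set of walks — no lattice input. (Equality also holds but is not needed.) [cite: GlazmanManolescu2019, §4.1 (proof of Proposition 1.1)] -/
theorem rotGF_eps_add_beta_le (M : ℕ) (V : Finset HV) :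
    rotGF V (IsRotSideEps M) + rotGF V (IsRotSideBeta M) ≤
      rotGF V (IsRotSideL M) + rotGF V (IsRotSideR M) := by
  simp only [rotGF, sum_filter, ← sum_add_distrib]
  refine sum_le_sum fun P _ => ?_
  have hf : 0 ≤ hexCriticalFugacity ^ mwLen P := pow_nonneg hexCriticalFugacity_pos_lt_one.1.le _
  by_cases hE : IsRotSideEps M (finalDart P)
  · have hB : ¬ IsRotSideBeta M (finalDart P) := fun hB => by
      have h1 := hE.2; have h2 := hB.2; omega
    rcases hE.1 with h | h
    · have hL : IsRotSideL M (finalDart P) := h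
      simp only [hE, hB, hL, if_true, if_false, add_zero]
      split_ifs <;> linarith
    · have hR : IsRotSideR M (finalDart P) := h
      simp only [hE, hB, hR, if_true, if_false, add_zero]
      split_ifs <;> linarith
  · by_cases hB : IsRotSideBeta M (finalDart P)
    · rcases hB.1 with h | h
      · have hL : IsRotSideL M (finalDart P) := h
        simp only [hE, hB, hL, if_true, if_false, zero_add]
        split_ifs <;> linarith
      · have hR : IsRotSideR M (finalDart P) := h
        simp only [hE, hB, hR, if_true, if_false, zero_add]
        split_ifs <;> linarith
    · simp only [hE, hB, if_false, add_zero]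
      split_ifs <;> linarith

/-- One of Beaton's coefficient inequalities for `2sin(π/16), 2sin(3π/16), 2cos(π/16), 2cos(3π/16), 2cos(7π/16)` (elementary trigonometry). [cite: Beaton2014RotatedHoneycomb, Proposition 4 (the coefficients)] -/
private theorem cE_le_cB : 2 * Real.cos (3 * Real.pi / 16) ≤ 2 * Real.cos (Real.pi / 16) := by
  have h := Real.cos_le_cos_of_nonneg_of_le_pi (x := Real.pi / 16) (y := 3 * Real.pi / 16)
    (by positivity) (by linarith [Real.pi_pos]) (by linarith [Real.pi_pos])
  linarith

/-- One of Beaton's coefficient inequalities for `2sin(π/16), 2sin(3π/16), 2cos(π/16), 2cos(3π/16), 2cos(7π/16)` (elementary trigonometry). [cite: Beaton2014RotatedHoneycomb, Proposition 4 (the coefficients)] -/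
private theorem cI_le_cO : 2 * Real.sin (Real.pi / 16) ≤ 2 * Real.sin (3 * Real.pi / 16) := by
  have h := Real.sin_le_sin_of_le_of_le_pi_div_two (x := Real.pi / 16) (y := 3 * Real.pi / 16)
    (by linarith [Real.pi_pos]) (by linarith [Real.pi_pos]) (by linarith [Real.pi_pos])
  linarith

/-- One of Beaton's coefficient inequalities for `2sin(π/16), 2sin(3π/16), 2cos(π/16), 2cos(3π/16), 2cos(7π/16)` (elementary trigonometry). [cite: Beaton2014RotatedHoneycomb, Proposition 4 (the coefficients)] -/
private theorem cB2_pos : 0 < 4 * Real.cos (Real.pi / 16) := by linarith [cB_pos]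

/-- **K95.4c PROVED — the chirality lower bound** `W_M ≤ 2c_B · m_M`, i.e.
`m_M = max(α_M, β_M) ≥ W_M / (2 c_B)` (`W_M = c_E D^ε + c_B D^β ≤ c_B (D^ε + D^β) ≤ c_B (α_M + β_M) ≤ 2 c_B m_M`).
`ctri_tm.py` check on `T_1, T_2, T_3`: `max(α,β) = 0.2896 / 0.2293 / 0.2012 ≥ W/(2c_B) = 0.2036 / 0.1787 / 0.1641`.
[cite: GlazmanManolescu2019, §4.1] -/
theorem rotTriW_le_chi (M : ℕ) : rotTriW M ≤ 4 * Real.cos (Real.pi / 16) * rotChi M := by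
  have hEB : rotGF ((rotTriV M).erase wOut) (IsRotSideEps M) + rotGF ((rotTriV M).erase wOut) (IsRotSideBeta M) ≤
      rotSideL M + rotSideR M := rotGF_eps_add_beta_le M _
  have hE0 := rotGF_nonneg ((rotTriV M).erase wOut) (IsRotSideEps M)
  have hL : rotSideL M ≤ rotChi M := le_max_left _ _
  have hR : rotSideR M ≤ rotChi M := le_max_right _ _
  have h1 := mul_le_mul_of_nonneg_right cE_le_cB hE0
  have h2 := mul_le_mul_of_nonneg_left hEB cB_pos.le
  have h3 := mul_le_mul_of_nonneg_left (add_le_add hL hR) cB_pos.le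
  unfold rotTriW
  linarith

/-! #### K95.4b — distance windows of the ratio-20 blocks -/

/-- a bottom exit of `D(H, W)` of out- or in-type in the DISTANCE WINDOW of block `M`:
`6M ≤ |X - 3| < 120M` in the `X`-units of ROUTES-G15 §2.7 (lattice distance from `a` in `[3M, 60M)`;
the tour of block `M` lands in `|X - 3| ∈ [6M+3, 54M+9]`). [cite: GlazmanManolescu2019, §4.1] -/
def IsRotBotWin (M : ℕ) (d : HV × HV) : Prop :=
  (IsRotBotOut d ∨ IsRotBotIn d) ∧ 6 * (M : ℤ) ≤ |xX d.2 - 3| ∧ |xX d.2 - 3| < 120 * (M : ℤ)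

/-- Decidability of the window class. [folklore] -/
instance (M : ℕ) : DecidablePred (IsRotBotWin M) := fun d => by unfold IsRotBotWin; infer_instance

/-- kernel sanity: the bottom-in dart `(11,1) → (10,0)`, i.e. `(-2,2,true) → (-1,2,false)`, lies in the
window of block `1` and not of block `20`. [folklore] -/
example : IsRotBotWin 1 (((-2 : ℤ), (2 : ℤ), true), ((-1 : ℤ), (2 : ℤ), false)) ∧
    ¬ IsRotBotWin 20 (((-2 : ℤ), (2 : ℤ), true), ((-1 : ℤ), (2 : ℤ), false)) := by decide

/-- the WINDOW MASS of block `M` in `D(H, W)` (right-started bottom exits in the window). [cite: GlazmanManolescu2019, §4.1 (proof of Proposition 1.1)] -/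
def rotBotWin (M H Wd : ℕ) : ℝ := rotGF ((rotStripV H Wd).erase wOut) (IsRotBotWin M)

/-- The window mass is nonnegative. [cite: GlazmanManolescu2019, §4.1 (proof of Proposition 1.1)] -/
theorem rotBotWin_nonneg (M H Wd : ℕ) : 0 ≤ rotBotWin M H Wd := rotGF_nonneg _ _

/-- the windows of the blocks `20^i` are pairwise disjoint. [cite: GlazmanManolescu2019, §4.1 (proof of Proposition 1.1)] -/
theorem botWin_unique {i j : ℕ} {d : HV × HV} (hi : IsRotBotWin (20 ^ i) d) (hj : IsRotBotWin (20 ^ j) d) :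
    i = j := by
  obtain ⟨-, hi1, hi2⟩ := hi
  obtain ⟨-, hj1, hj2⟩ := hj
  push_cast at hi1 hi2 hj1 hj2
  by_contra hne
  rcases Nat.lt_or_gt_of_ne hne with h | h
  · have h' : (20 : ℤ) ^ (i + 1) ≤ 20 ^ j := pow_le_pow_right₀ (by norm_num) (Nat.succ_le_of_lt h)
    rw [pow_succ] at h'
    linarith
  · have h' : (20 : ℤ) ^ (j + 1) ≤ 20 ^ i := pow_le_pow_right₀ (by norm_num) (Nat.succ_le_of_lt h)
    rw [pow_succ] at h'
    linarith

/-- pointwise form: a dart lies in at most one window, and a window dart is bottom-out or bottom-in. [cite: GlazmanManolescu2019, §4.1 (proof of Proposition 1.1)] -/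
theorem botWin_indicator_sum_le (m : ℕ) (d : HV × HV) {f : ℝ} (hf : 0 ≤ f) :
    ∑ i ∈ range (m + 1), (if IsRotBotWin (20 ^ i) d then f else 0) ≤
      (if IsRotBotOut d then f else 0) + (if IsRotBotIn d then f else 0) := by
  by_cases h : ∃ i ∈ range (m + 1), IsRotBotWin (20 ^ i) d
  · obtain ⟨i, hi, hW⟩ := h
    rw [sum_eq_single_of_mem i hi (fun j _ hji => if_neg (fun hW' => hji (botWin_unique hW' hW)))]
    rw [if_pos hW]
    rcases hW.1 with hO | hI
    · rw [if_pos hO]; split_ifs <;> linarith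
    · rw [if_pos hI]; split_ifs <;> linarith
  · simp only [not_exists, not_and] at h
    rw [sum_eq_zero (fun i hi => if_neg (h i hi))]
    split_ifs <;> linarith

/-- **K95.4b PROVED — window bookkeeping**: the window masses of the blocks `20^0, …, 20^m` add up
inside the total bottom mass `A^O + A^I` of the big domain. [cite: GlazmanManolescu2019, §4.1 (proof of Proposition 1.1)] -/
theorem rotBotWin_sum_le (m H Wd : ℕ) :
    ∑ i ∈ range (m + 1), rotBotWin (20 ^ i) H Wd ≤
      rotGF ((rotStripV H Wd).erase wOut) IsRotBotOut + rotGF ((rotStripV H Wd).erase wOut) IsRotBotIn := by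
  simp only [rotBotWin, rotGF, sum_filter]
  rw [sum_comm, ← sum_add_distrib]
  exact sum_le_sum fun P _ =>
    botWin_indicator_sum_le m (finalDart P) (pow_nonneg hexCriticalFugacity_pos_lt_one.1.le _)

/-- total bottom mass `A^O + A^I ≤ (K/2)/c_I` from the strip identity K95.1 (`c_I ≤ c_O`).
[cite: Beaton2014RotatedHoneycomb, Proposition 4] -/
theorem rotBot_le_K {H Wd : ℕ} (hH : 1 ≤ H) (hW : 1 ≤ Wd) :
    rotGF ((rotStripV H Wd).erase wOut) IsRotBotOut + rotGF ((rotStripV H Wd).erase wOut) IsRotBotIn ≤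
      2 * hexCriticalFugacity * Real.cos (Real.pi / 16) / (2 * Real.sin (Real.pi / 16)) := by
  have e := rotStrip_identity hH hW
  rw [le_div_iff₀ cI_pos]
  have hO0 := rotGF_nonneg ((rotStripV H Wd).erase wOut) IsRotBotOut
  have h2 := mul_le_mul_of_nonneg_right cI_le_cO hO0
  linarith [mul_nonneg cE_pos.le (rotGF_nonneg ((rotStripV H Wd).erase wOut) (IsRotLatDart H Wd)),
    mul_nonneg cB_pos.le (rotGF_nonneg ((rotStripV H Wd).erase wOut) (IsRotTopDart H)),
    mul_nonneg cP_pos.le (rotGF_nonneg ((rotStripV H Wd).erase wOut) IsRotCloseDart)]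


end Literature.Probability.RandomPlanarGeometry.SAW.HV

/-! ## Section: HexSAWRotTourFrame -/

namespace Literature.Probability.RandomPlanarGeometry.SAW.HV

/-- **Rotation by `π/3` about the corner `c₀ = (X, h) = (-6M, 0)` of `T_M`** (a hexagon centre): the
tree's `rot60` (rotation about the centre `(3, 1)` of the hexagon on the edge `a⁻a⁺`, which maps
`a⁻ ↦ a⁺`) conjugated by the lattice translation `(ΔX, Δξ) = (-6M-3, +1)` = `shift (M+1) (-2M-1)`.
[cite: GlazmanManolescu2019, §4.1 ("the rotation by π/3"); Beaton2014RotatedHoneycomb, §3.1] -/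
def rotC0 (M : ℕ) : hvGraph ≃g hvGraph :=
  ((shift (-(M : ℤ) - 1) (2 * (M : ℤ) + 1)).trans rot60).trans (shift ((M : ℤ) + 1) (-(2 : ℤ) * M - 1))

/-- `rotC0` in coordinates: `(x₀, x₁, b) ↦ (-x₁ - M - 1, x₀ + x₁ + b - M - 1, ¬b)`. [cite: GlazmanManolescu2019, §4.1 (proof of Proposition 1.1: the three rotated copies of the triangle, arXiv:1708.00395v3 p. 13, Fig. 6); Beaton2014RotatedHoneycomb, §2.2 (the rotated frame)] -/
@[simp] theorem rotC0_apply (M : ℕ) (v : HV) :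
    rotC0 M v = (-v.2.1 - (M : ℤ) - 1, v.1 + v.2.1 + bit v - (M : ℤ) - 1, !v.2.2) := by
  obtain ⟨a, b, c⟩ := v
  show shift ((M : ℤ) + 1) (-(2 : ℤ) * M - 1) (rot60 (shift (-(M : ℤ) - 1) (2 * (M : ℤ) + 1) (a, b, c))) = _
  cases c
  · simp only [shift_apply, rot60_apply, bit_false, Bool.not_false]
    refine Prod.ext ?_ (Prod.ext ?_ rfl) <;> dsimp only <;> omega
  · simp only [shift_apply, rot60_apply, bit_true, Bool.not_true]
    refine Prod.ext ?_ (Prod.ext ?_ rfl) <;> dsimp only <;> omega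

/-- `rotC0` IS the `+π/3` rotation about `c₀` in the integer model, height part: `2ξ' = ξ - X - 6M`
(i.e. `h' = (P + h)/2`). [cite: Beaton2014RotatedHoneycomb, §3.1 (Fig. 3)] -/
theorem two_mul_xi_rotC0 (M : ℕ) (v : HV) : 2 * xi (rotC0 M v) = xi v - xX v - 6 * M := by
  obtain ⟨a, b, c⟩ := v
  cases c <;> simp [xi, xX] <;> omega

/-- `rotC0` in the integer model, abscissa part: `2(X' + 6M) = X + 6M + 3ξ` (i.e. `P' = (P - 3h)/2`).
[cite: Beaton2014RotatedHoneycomb, §3.1 (Fig. 3)] -/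
theorem two_mul_xX_rotC0 (M : ℕ) (v : HV) :
    2 * (xX (rotC0 M v) + 6 * M) = xX v + 6 * M + 3 * xi v := by
  obtain ⟨a, b, c⟩ := v
  cases c <;> simp [xi, xX] <;> omega

/-- **Translation along `ℓ`** by `3(k - M)` edges (`ΔX = 6(k-M)` half-edges, `Δξ = 0`): takes `T_k` to
the triangle `T'_k` with base `[c₀, c₀ + 6(2k+1)]` (ROUTES-G15 §2.3 S3). [cite: GlazmanManolescu2019, §4.1
("the translate of γ⁽²⁾")] -/
def slideL (M k : ℕ) : hvGraph ≃g hvGraph := shift ((M : ℤ) - k) (2 * (k : ℤ) - 2 * M)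

/-- `slideL` preserves the height. [cite: GlazmanManolescu2019, §4.1 (proof of Proposition 1.1: the three rotated copies of the triangle, arXiv:1708.00395v3 p. 13, Fig. 6); Beaton2014RotatedHoneycomb, §2.2 (the rotated frame)] -/
@[simp] theorem xi_slideL (M k : ℕ) (v : HV) : xi (slideL M k v) = xi v := by
  obtain ⟨a, b, c⟩ := v
  cases c <;> simp [slideL, xi] <;> omega

/-- `slideL` shifts the abscissa by `6(k - M)`. [cite: GlazmanManolescu2019, §4.1 (proof of Proposition 1.1: the three rotated copies of the triangle, arXiv:1708.00395v3 p. 13, Fig. 6); Beaton2014RotatedHoneycomb, §2.2 (the rotated frame)] -/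
@[simp] theorem xX_slideL (M k : ℕ) (v : HV) : xX (slideL M k v) = xX v + 6 * k - 6 * M := by
  obtain ⟨a, b, c⟩ := v
  cases c <;> simp [slideL, xX] <;> omega

/-- **Placement of piece 2**: `Φ₂ = rotC0 ∘ slideL` — `T_k` slid to `T'_k`, then rotated by `π/3` about
`c₀` into the sector `Σ₂ = (60°, 120°)`. [cite: GlazmanManolescu2019, §4.1 (placement of γ⁽²⁾)] -/
def rotPhi2 (M k : ℕ) : hvGraph ≃g hvGraph := (slideL M k).trans (rotC0 M)

/-- **Placement of piece 3**: `Φ₃ = rotC0² ∘ slideL` (rotation by `2π/3`, into `Σ₃ = (120°, 180°)`).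
[cite: GlazmanManolescu2019, §4.1 (placement of γ⁽³⁾)] -/
def rotPhi3 (M k : ℕ) : hvGraph ≃g hvGraph := (slideL M k).trans ((rotC0 M).trans (rotC0 M))

/-- `Φ₂ = rotC0 ∘ slideL`, pointwise. [cite: GlazmanManolescu2019, §4.1 (proof of Proposition 1.1: the three rotated copies of the triangle, arXiv:1708.00395v3 p. 13, Fig. 6); Beaton2014RotatedHoneycomb, §2.2 (the rotated frame)] -/
theorem rotPhi2_eq (M k : ℕ) (v : HV) : rotPhi2 M k v = rotC0 M (slideL M k v) := rfl
/-- `Φ₃ = rotC0² ∘ slideL`, pointwise. [cite: GlazmanManolescu2019, §4.1 (proof of Proposition 1.1: the three rotated copies of the triangle, arXiv:1708.00395v3 p. 13, Fig. 6); Beaton2014RotatedHoneycomb, §2.2 (the rotated frame)] -/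
theorem rotPhi3_eq (M k : ℕ) (v : HV) : rotPhi3 M k v = rotC0 M (rotC0 M (slideL M k v)) := rfl

/-- `Φ₂` on heights: `2ξ' = ξ - X - 6k`. [cite: GlazmanManolescu2019, §4.1 (proof of Proposition 1.1: the three rotated copies of the triangle, arXiv:1708.00395v3 p. 13, Fig. 6); Beaton2014RotatedHoneycomb, §2.2 (the rotated frame)] -/
theorem two_mul_xi_rotPhi2 (M k : ℕ) (v : HV) : 2 * xi (rotPhi2 M k v) = xi v - xX v - 6 * k := by
  rw [rotPhi2_eq, two_mul_xi_rotC0, xi_slideL, xX_slideL]; ring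

/-- `Φ₂` on abscissae: `2(X' + 6M) = X + 6k + 3ξ`. [cite: GlazmanManolescu2019, §4.1 (proof of Proposition 1.1: the three rotated copies of the triangle, arXiv:1708.00395v3 p. 13, Fig. 6); Beaton2014RotatedHoneycomb, §2.2 (the rotated frame)] -/
theorem two_mul_xX_rotPhi2 (M k : ℕ) (v : HV) :
    2 * (xX (rotPhi2 M k v) + 6 * M) = xX v + 6 * k + 3 * xi v := by
  rw [rotPhi2_eq, two_mul_xX_rotC0, xi_slideL, xX_slideL]; ring

/-- `Φ₃` on heights: `2ξ'' = -ξ - X - 6k`. [cite: GlazmanManolescu2019, §4.1 (proof of Proposition 1.1: the three rotated copies of the triangle, arXiv:1708.00395v3 p. 13, Fig. 6); Beaton2014RotatedHoneycomb, §2.2 (the rotated frame)] -/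
theorem two_mul_xi_rotPhi3 (M k : ℕ) (v : HV) : 2 * xi (rotPhi3 M k v) = -xi v - xX v - 6 * k := by
  have h1 := two_mul_xi_rotC0 M (rotC0 M (slideL M k v))
  have h2 := two_mul_xi_rotC0 M (slideL M k v)
  have h3 := two_mul_xX_rotC0 M (slideL M k v)
  rw [xi_slideL, xX_slideL] at h2 h3
  rw [rotPhi3_eq]; omega

/-- `Φ₃` on abscissae: `2(X'' + 6M) = 3ξ - X - 6k`. [cite: GlazmanManolescu2019, §4.1 (proof of Proposition 1.1: the three rotated copies of the triangle, arXiv:1708.00395v3 p. 13, Fig. 6); Beaton2014RotatedHoneycomb, §2.2 (the rotated frame)] -/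
theorem two_mul_xX_rotPhi3 (M k : ℕ) (v : HV) :
    2 * (xX (rotPhi3 M k v) + 6 * M) = 3 * xi v - xX v - 6 * k := by
  have h1 := two_mul_xX_rotC0 M (rotC0 M (slideL M k v))
  have h2 := two_mul_xi_rotC0 M (slideL M k v)
  have h3 := two_mul_xX_rotC0 M (slideL M k v)
  rw [xi_slideL, xX_slideL] at h2 h3
  rw [rotPhi3_eq]; omega

/-! ### The junction: images of `a'⁻`, `a'⁺` = the endpoints of ray-edge `k` -/

/-- `Φ₂(a⁻) = u_k = (M - 2k, k - 1 - 2M, false)`, the LOWER endpoint of ray-edge `k` on the `60°`-ray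
(`X + 6M = h = 3k + 1`). [cite: GlazmanManolescu2019, §4.1 (proof of Proposition 1.1, arXiv:1708.00395v3 p. 13), lane ROUTES-G15 §2.3 S4] -/
theorem rotPhi2_wOut (M k : ℕ) : rotPhi2 M k wOut = ((M : ℤ) - 2 * k, (k : ℤ) - 1 - 2 * M, false) := by
  rw [rotPhi2_eq]
  simp only [slideL, wOut, shift_apply, rotC0_apply, bit_true, Bool.not_true]
  refine Prod.ext ?_ (Prod.ext ?_ rfl) <;> dsimp only <;> omega

/-- `Φ₂(a⁺) = u'_k = (M - 2k - 1, k - 1 - 2M, true)`, the UPPER endpoint of ray-edge `k` (`h = 3k + 2`).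
[cite: GlazmanManolescu2019, §4.1 (proof of Proposition 1.1, arXiv:1708.00395v3 p. 13), lane ROUTES-G15 §2.3 S4] -/
theorem rotPhi2_hvOrigin (M k : ℕ) :
    rotPhi2 M k hvOrigin = ((M : ℤ) - 2 * k - 1, (k : ℤ) - 1 - 2 * M, true) := by
  rw [rotPhi2_eq]
  simp only [slideL, hvOrigin, shift_apply, rotC0_apply, bit_false, Bool.not_false]
  refine Prod.ext ?_ (Prod.ext ?_ rfl) <;> dsimp only <;> omega

/-- Ray-edge `k`: `u_k` sits on the `60°`-ray (`X + 6M = h`) at height `3k + 1`. [cite: GlazmanManolescu2019, §4.1 (proof of Proposition 1.1: the three rotated copies of the triangle, arXiv:1708.00395v3 p. 13, Fig. 6); Beaton2014RotatedHoneycomb, §2.2 (the rotated frame)] -/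
theorem rotPhi2_wOut_coords (M k : ℕ) :
    xi (rotPhi2 M k wOut) = -(3 * k + 1) ∧ xX (rotPhi2 M k wOut) + 6 * M = 3 * k + 1 := by
  rw [rotPhi2_wOut]; simp [xi, xX]; omega

/-- … and `u'_k` at height `3k + 2`. [cite: GlazmanManolescu2019, §4.1 (proof of Proposition 1.1: the three rotated copies of the triangle, arXiv:1708.00395v3 p. 13, Fig. 6); Beaton2014RotatedHoneycomb, §2.2 (the rotated frame)] -/
theorem rotPhi2_hvOrigin_coords (M k : ℕ) :
    xi (rotPhi2 M k hvOrigin) = -(3 * k + 2) ∧ xX (rotPhi2 M k hvOrigin) + 6 * M = 3 * k + 2 := by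
  rw [rotPhi2_hvOrigin]; simp [xi, xX]; omega

/-- Ray-edge `k` IS an edge of `ℍ` (image of the edge `a⁻a⁺`). [cite: GlazmanManolescu2019, §4.1 (proof of Proposition 1.1: the three rotated copies of the triangle, arXiv:1708.00395v3 p. 13, Fig. 6); Beaton2014RotatedHoneycomb, §2.2 (the rotated frame)] -/
theorem rotPhi2_junction_adj (M k : ℕ) : hvGraph.Adj (rotPhi2 M k wOut) (rotPhi2 M k hvOrigin) :=
  (rotPhi2 M k).map_adj_iff.2 (by decide)

/-- `Φ₃(a⁻)`, `Φ₃(a⁺)` = the endpoints of ray-edge `k` on the `120°`-ray (`X + 6M = -h`), heights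
`3k + 1`, `3k + 2`. [cite: GlazmanManolescu2019, §4.1] -/
theorem rotPhi3_base_coords (M k : ℕ) :
    (xi (rotPhi3 M k wOut) = -(3 * k + 1) ∧ xX (rotPhi3 M k wOut) + 6 * M = -(3 * k + 1)) ∧
    (xi (rotPhi3 M k hvOrigin) = -(3 * k + 2) ∧ xX (rotPhi3 M k hvOrigin) + 6 * M = -(3 * k + 2)) := by
  have h1 := two_mul_xi_rotPhi3 M k wOut
  have h2 := two_mul_xX_rotPhi3 M k wOut
  have h3 := two_mul_xi_rotPhi3 M k hvOrigin
  have h4 := two_mul_xX_rotPhi3 M k hvOrigin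
  rw [xi_wOut, xX_wOut] at h1 h2
  rw [xi_hvOrigin, xX_hvOrigin] at h3 h4
  omega

/-- Kernel sanity at `M = 1`: the junction vertices of ray-edges `k = 0, 1, 2` in coordinates, and that
they are NOT vertices of `T_1` (side-line vertices are exit targets, outside `V`). [folklore] -/
example : rotPhi2 1 0 wOut = ((1 : ℤ), (-3 : ℤ), false) ∧ rotPhi2 1 1 wOut = ((-1 : ℤ), (-2 : ℤ), false) ∧
    rotPhi2 1 2 hvOrigin = ((-4 : ℤ), (-1 : ℤ), true) := by
  simp only [rotPhi2_wOut, rotPhi2_hvOrigin, Prod.mk.injEq]; norm_num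
example : ((1 : ℤ), (-3 : ℤ), false) ∉ rotTriV 1 ∧ ((-1 : ℤ), (-2 : ℤ), false) ∉ rotTriV 1 ∧
    ((-4 : ℤ), (-1 : ℤ), true) ∉ rotTriV 1 := by decide

/-! ### The three open sectors at `c₀` and containment (T3) -/

/-- `Σ₁ = (0°, 60°)`: strictly right of the `60°`-ray (`X + 6M > h ≥ 1`); contains `T_M ∖ {a∓}`. [cite: GlazmanManolescu2019, §4.1 (proof of Proposition 1.1: the three rotated copies of the triangle, arXiv:1708.00395v3 p. 13, Fig. 6); Beaton2014RotatedHoneycomb, §2.2 (the rotated frame)] -/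
def InSector1 (M : ℕ) (v : HV) : Prop := 1 ≤ -xi v ∧ -(6 : ℤ) * M - xi v < xX v
/-- `Σ₂ = (60°, 120°)`: `|X + 6M| < h`. [cite: GlazmanManolescu2019, §4.1 (proof of Proposition 1.1: the three rotated copies of the triangle, arXiv:1708.00395v3 p. 13, Fig. 6); Beaton2014RotatedHoneycomb, §2.2 (the rotated frame)] -/
def InSector2 (M : ℕ) (v : HV) : Prop := 1 ≤ -xi v ∧ |xX v + 6 * M| < -xi v
/-- `Σ₃ = (120°, 180°)`: `X + 6M < -h ≤ -1`. [cite: GlazmanManolescu2019, §4.1 (proof of Proposition 1.1: the three rotated copies of the triangle, arXiv:1708.00395v3 p. 13, Fig. 6); Beaton2014RotatedHoneycomb, §2.2 (the rotated frame)] -/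
def InSector3 (M : ℕ) (v : HV) : Prop := 1 ≤ -xi v ∧ xX v + 6 * M < xi v

/-- The sectors are pairwise disjoint. [cite: GlazmanManolescu2019, §4.1 (proof of Proposition 1.1: the three rotated copies of the triangle, arXiv:1708.00395v3 p. 13, Fig. 6); Beaton2014RotatedHoneycomb, §2.2 (the rotated frame)] -/
theorem sector_disjoint (M : ℕ) (v : HV) :
    (InSector1 M v → ¬InSector2 M v) ∧ (InSector1 M v → ¬InSector3 M v) ∧
      (InSector2 M v → ¬InSector3 M v) := by
  refine ⟨fun h1 h2 => ?_, fun h1 h3 => ?_, fun h2 h3 => ?_⟩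
  · have := (abs_lt.1 h2.2).2; unfold InSector1 at h1; omega
  · unfold InSector1 at h1; unfold InSector3 at h3; omega
  · have := (abs_lt.1 h2.2).1; unfold InSector3 at h3; omega

/-- `T_M ∖ {a⁻, a⁺} ⊂ Σ₁`. [cite: GlazmanManolescu2019, §4.1 (proof of Proposition 1.1: the three rotated copies of the triangle, arXiv:1708.00395v3 p. 13, Fig. 6); Beaton2014RotatedHoneycomb, §2.2 (the rotated frame)] -/
theorem inSector1_of_mem_rotTriV {M : ℕ} {v : HV} (hv : v ∈ rotTriV M) (h1 : v ≠ wOut)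
    (h2 : v ≠ hvOrigin) : InSector1 M v := by
  rcases mem_rotTriV_iff.1 hv with rfl | rfl | ⟨ha, hb, -⟩
  · exact absurd rfl h1
  · exact absurd rfl h2
  · exact ⟨ha, hb⟩

/-- **Piece 2 lives in `Σ₂`, below row `6k + 3`**: `Φ₂(T_k ∖ {a∓}) ⊂ Σ₂ ∩ {h ≤ 6k + 2}`.
[cite: GlazmanManolescu2019, §4.1 ("the three pieces live in the three disjoint sectors")] -/
theorem inSector2_rotPhi2 {M k : ℕ} {v : HV} (hv : v ∈ rotTriV k) (h1 : v ≠ wOut) (h2 : v ≠ hvOrigin) :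
    InSector2 M (rotPhi2 M k v) ∧ -xi (rotPhi2 M k v) ≤ 6 * k + 2 := by
  rcases mem_rotTriV_iff.1 hv with rfl | rfl | ⟨ha, hb, hc⟩
  · exact absurd rfl h1
  · exact absurd rfl h2
  have e1 := two_mul_xi_rotPhi2 M k v
  have e2 := two_mul_xX_rotPhi2 M k v
  refine ⟨⟨by omega, abs_lt.2 ⟨by omega, by omega⟩⟩, by omega⟩

/-- **Piece 3 lives in `Σ₃`, below row `6k + 3`**: `Φ₃(T_k ∖ {a∓}) ⊂ Σ₃ ∩ {h ≤ 6k + 2}`.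
[cite: GlazmanManolescu2019, §4.1] -/
theorem inSector3_rotPhi3 {M k : ℕ} {v : HV} (hv : v ∈ rotTriV k) (h1 : v ≠ wOut) (h2 : v ≠ hvOrigin) :
    InSector3 M (rotPhi3 M k v) ∧ -xi (rotPhi3 M k v) ≤ 6 * k + 2 := by
  rcases mem_rotTriV_iff.1 hv with rfl | rfl | ⟨ha, hb, hc⟩
  · exact absurd rfl h1
  · exact absurd rfl h2
  have e1 := two_mul_xi_rotPhi3 M k v
  have e2 := two_mul_xX_rotPhi3 M k v
  exact ⟨⟨by omega, by omega⟩, by omega⟩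

/-- Consequently the three piece-domains are pairwise disjoint (vertex level): no vertex of `T_M ∖ {a∓}`
is a `Φ₂`- or `Φ₃`-image of a vertex of `T_k ∖ {a∓}`, and no `Φ₂`-image is a `Φ₃`-image. [cite: GlazmanManolescu2019, §4.1 (proof of Proposition 1.1: the three rotated copies of the triangle, arXiv:1708.00395v3 p. 13, Fig. 6); Beaton2014RotatedHoneycomb, §2.2 (the rotated frame)] -/
theorem pieces_disjoint {M k k' : ℕ} {u v w : HV} (hu : u ∈ rotTriV M) (hu1 : u ≠ wOut) (hu2 : u ≠ hvOrigin)
    (hv : v ∈ rotTriV k) (hv1 : v ≠ wOut) (hv2 : v ≠ hvOrigin)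
    (hw : w ∈ rotTriV k') (hw1 : w ≠ wOut) (hw2 : w ≠ hvOrigin) :
    u ≠ rotPhi2 M k v ∧ u ≠ rotPhi3 M k' w ∧ rotPhi2 M k v ≠ rotPhi3 M k' w := by
  have s1 := inSector1_of_mem_rotTriV hu hu1 hu2
  have s2 := (inSector2_rotPhi2 (M := M) hv hv1 hv2).1
  have s3 := (inSector3_rotPhi3 (M := M) hw hw1 hw2).1
  refine ⟨fun h => ?_, fun h => ?_, fun h => ?_⟩
  · exact (sector_disjoint M u).1 s1 (h ▸ s2)
  · exact (sector_disjoint M u).2.1 s1 (h ▸ s3)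
  · exact (sector_disjoint M _).2.2 s2 (h ▸ s3)

/-- **Where piece 2 exits**: `Φ₂` maps the LEFT side line of `T_k` (`X + 6k = h`) onto the `120°`-ray
(`X + 6M = -h`), preserving the height. [cite: GlazmanManolescu2019, §4.1] -/
theorem rotPhi2_leftLine {M k : ℕ} {v : HV} (h : xX v = -(6 : ℤ) * k - xi v) :
    xX (rotPhi2 M k v) + 6 * M = xi (rotPhi2 M k v) ∧ xi (rotPhi2 M k v) = xi v := by
  have e1 := two_mul_xi_rotPhi2 M k v
  have e2 := two_mul_xX_rotPhi2 M k v
  omega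

/-- **Where piece 3 exits**: `Φ₃` maps the left side line of `T_k` onto `ℓ` (`ξ = 0`) at abscissa
`X = -6M + 2ξ(v)`, i.e. at distance `|X - 3| = 6M + 3 + 2h(v) ∈ [6M + 5, 6M + 12k + 7]` LEFT of `a` — a
bottom exit of the big strip inside the window of block `M` (`6M ≤ |X-3| < 120M` for `k ≤ 4M`).
[cite: GlazmanManolescu2019, §4.1 ("a walk contributing to G(-L, K₃)")] -/
theorem rotPhi3_leftLine {M k : ℕ} {v : HV} (h : xX v = -(6 : ℤ) * k - xi v) :
    xi (rotPhi3 M k v) = 0 ∧ xX (rotPhi3 M k v) = -(6 : ℤ) * M + 2 * xi v := by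
  have e1 := two_mul_xi_rotPhi3 M k v
  have e2 := two_mul_xX_rotPhi3 M k v
  omega

/-- The landing abscissa of piece 3 lies in block `M`'s window when `1 ≤ h(v) ≤ 6k + 2`, `k ≤ 4M`, `M ≥ 1`.
[cite: GlazmanManolescu2019, §4.1 (p. 11, the dyadic blocks)] -/
theorem rotPhi3_window {M k : ℕ} {v : HV} (hM : 1 ≤ M) (hk : k ≤ 4 * M) (h : xX v = -(6 : ℤ) * k - xi v)
    (h1 : 1 ≤ -xi v) (h2 : -xi v ≤ 6 * k + 2) :
    6 * (M : ℤ) ≤ |xX (rotPhi3 M k v) - 3| ∧ |xX (rotPhi3 M k v) - 3| < 120 * M := by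
  obtain ⟨-, e⟩ := rotPhi3_leftLine (M := M) h
  rw [e, abs_of_neg (by omega)]
  constructor <;> omega

/-- **Containment of piece 2 in the big strip** (`H, W ≥ 28M`, `k ≤ 2M`, `M ≥ 1`): rows `≤ 6k+2 ≤ 12M+2`,
`|X - 3| ≤ 18M + 5 < 84M ≤ 3W`. [cite: GlazmanManolescu2019, §4.1 (T' ≥ 8L+1, L'' ≥ 9L+1 analogue)] -/
theorem rotPhi2_mem_rotStripV {M k H Wd : ℕ} (hM : 1 ≤ M) (hk : k ≤ 2 * M) (hH : 28 * M ≤ H)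
    (hW : 28 * M ≤ Wd) {v : HV} (hv : v ∈ rotTriV k) (h1 : v ≠ wOut) (h2 : v ≠ hvOrigin) :
    rotPhi2 M k v ∈ rotStripV H Wd := by
  obtain ⟨⟨ha, hb⟩, hc⟩ := inSector2_rotPhi2 (M := M) hv h1 h2
  have hb' := abs_lt.1 hb
  refine mem_rotStripV_iff.2 (Or.inr (Or.inr ⟨ha, by omega, abs_lt.2 ⟨by omega, by omega⟩⟩))

/-- **Containment of piece 3 in the big strip** (`H, W ≥ 28M`, `k ≤ 4M`, `M ≥ 1`): rows `≤ 24M + 2`,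
`|X - 3| ≤ 54M + 8 < 84M`. [cite: GlazmanManolescu2019, §4.1] -/
theorem rotPhi3_mem_rotStripV {M k H Wd : ℕ} (hM : 1 ≤ M) (hk : k ≤ 4 * M) (hH : 28 * M ≤ H)
    (hW : 28 * M ≤ Wd) {v : HV} (hv : v ∈ rotTriV k) (h1 : v ≠ wOut) (h2 : v ≠ hvOrigin) :
    rotPhi3 M k v ∈ rotStripV H Wd := by
  rcases mem_rotTriV_iff.1 hv with rfl | rfl | ⟨ha, hb, hc'⟩
  · exact absurd rfl h1
  · exact absurd rfl h2
  have e1 := two_mul_xi_rotPhi3 M k v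
  have e2 := two_mul_xX_rotPhi3 M k v
  refine mem_rotStripV_iff.2 (Or.inr (Or.inr ⟨by omega, by omega, abs_lt.2 ⟨by omega, by omega⟩⟩))

/-- The junction vertices themselves lie in the big strip (`k ≤ 4M`, `H, W ≥ 28M`). [cite: GlazmanManolescu2019, §4.1 (proof of Proposition 1.1: the three rotated copies of the triangle, arXiv:1708.00395v3 p. 13, Fig. 6); Beaton2014RotatedHoneycomb, §2.2 (the rotated frame)] -/
theorem junction_mem_rotStripV {M k H Wd : ℕ} (hM : 1 ≤ M) (hk : k ≤ 4 * M) (hH : 28 * M ≤ H)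
    (hW : 28 * M ≤ Wd) :
    rotPhi2 M k wOut ∈ rotStripV H Wd ∧ rotPhi2 M k hvOrigin ∈ rotStripV H Wd ∧
      rotPhi3 M k wOut ∈ rotStripV H Wd ∧ rotPhi3 M k hvOrigin ∈ rotStripV H Wd := by
  obtain ⟨a1, a2⟩ := rotPhi2_wOut_coords M k
  obtain ⟨b1, b2⟩ := rotPhi2_hvOrigin_coords M k
  obtain ⟨⟨c1, c2⟩, ⟨d1, d2⟩⟩ := rotPhi3_base_coords M k
  refine ⟨?_, ?_, ?_, ?_⟩ <;>
    refine mem_rotStripV_iff.2 (Or.inr (Or.inr ⟨by omega, by omega, abs_lt.2 ⟨by omega, by omega⟩⟩))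

/-- **The junction edge is a LEFT-side exit target of `T_M`** for `k ≤ 2M`: both endpoints of ray-edge `k`
satisfy the left side-line equation `X = -6M - ξ` of `IsRotSideL M` (so a piece-1 walk whose final dart
ends at `u_k` or `u'_k` is a left exit, of type β resp. ε according to its last edge). [cite: GlazmanManolescu2019, §4.1 (proof of Proposition 1.1: the three rotated copies of the triangle, arXiv:1708.00395v3 p. 13, Fig. 6); Beaton2014RotatedHoneycomb, §2.2 (the rotated frame)] -/
theorem junction_on_leftLine (M k : ℕ) :
    xX (rotPhi2 M k wOut) = -(6 : ℤ) * M - xi (rotPhi2 M k wOut) ∧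
      xX (rotPhi2 M k hvOrigin) = -(6 : ℤ) * M - xi (rotPhi2 M k hvOrigin) := by
  obtain ⟨a1, a2⟩ := rotPhi2_wOut_coords M k
  obtain ⟨b1, b2⟩ := rotPhi2_hvOrigin_coords M k
  omega

/-! ### The mirror `X ↦ 6 - X` (exchanges the two start classes and the two sides) -/

/-- **Reflection in the axis `X = 3` through `a`** (perpendicular to `ℓ`): `(x₀, x₁, b) ↦ (x₀ + x₁ + b,
-x₁ - 1, ¬b)` = `reflT ≫ flip`; it fixes heights, sends `X ↦ 6 - X`, swaps `a⁻ ↔ a⁺`, preserves every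
`T_M` and `D(H, W)` and exchanges left/right side exits — so a LEFT-started left-exiting walk of `T_k`
(the class "β" of the ray-edge shuffle, ROUTES-G15 §2.3 S4) is the mirror of a right-started RIGHT-exiting
one, whose mass is `rotSideR k`. [cite: Beaton2014RotatedHoneycomb, §3.1 (reflection symmetry of D_{T,L})] -/
def reflX : hvGraph ≃g hvGraph := reflT.trans flip

/-- `reflX` in coordinates. [cite: GlazmanManolescu2019, §4.1 (proof of Proposition 1.1: the three rotated copies of the triangle, arXiv:1708.00395v3 p. 13, Fig. 6); Beaton2014RotatedHoneycomb, §2.2 (the rotated frame)] -/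
@[simp] theorem reflX_apply (v : HV) : reflX v = (v.1 + v.2.1 + bit v, -v.2.1 - 1, !v.2.2) := by
  obtain ⟨a, b, c⟩ := v
  show flip (reflT (a, b, c)) = _
  cases c
  · simp only [reflT_apply, flip_apply, bit_false]
    refine Prod.ext ?_ (Prod.ext ?_ rfl)
    all_goals first | rfl | (dsimp only; omega)
  · simp only [reflT_apply, flip_apply, bit_true]
    refine Prod.ext ?_ (Prod.ext ?_ rfl)
    all_goals first | rfl | (dsimp only; omega)

/-- `reflX` fixes heights. [cite: GlazmanManolescu2019, §4.1 (proof of Proposition 1.1: the three rotated copies of the triangle, arXiv:1708.00395v3 p. 13, Fig. 6); Beaton2014RotatedHoneycomb, §2.2 (the rotated frame)] -/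
@[simp] theorem xi_reflX (v : HV) : xi (reflX v) = xi v := by
  obtain ⟨a, b, c⟩ := v; cases c <;> (simp [xi]; omega)

/-- `reflX` is `X ↦ 6 - X`. [cite: GlazmanManolescu2019, §4.1 (proof of Proposition 1.1: the three rotated copies of the triangle, arXiv:1708.00395v3 p. 13, Fig. 6); Beaton2014RotatedHoneycomb, §2.2 (the rotated frame)] -/
@[simp] theorem xX_reflX (v : HV) : xX (reflX v) = 6 - xX v := by
  obtain ⟨a, b, c⟩ := v; cases c <;> (simp [xX]; omega)

/-- `reflX` swaps `a⁻` and `a⁺`. [cite: GlazmanManolescu2019, §4.1 (proof of Proposition 1.1: the three rotated copies of the triangle, arXiv:1708.00395v3 p. 13, Fig. 6); Beaton2014RotatedHoneycomb, §2.2 (the rotated frame)] -/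
theorem reflX_wOut : reflX wOut = hvOrigin := by decide
/-- `reflX` swaps `a⁺` and `a⁻`. [cite: GlazmanManolescu2019, §4.1 (proof of Proposition 1.1: the three rotated copies of the triangle, arXiv:1708.00395v3 p. 13, Fig. 6); Beaton2014RotatedHoneycomb, §2.2 (the rotated frame)] -/
theorem reflX_hvOrigin : reflX hvOrigin = wOut := by decide
/-- `reflX` is an involution. [cite: GlazmanManolescu2019, §4.1 (proof of Proposition 1.1: the three rotated copies of the triangle, arXiv:1708.00395v3 p. 13, Fig. 6); Beaton2014RotatedHoneycomb, §2.2 (the rotated frame)] -/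
theorem reflX_reflX (v : HV) : reflX (reflX v) = v := by
  obtain ⟨a, b, c⟩ := v
  cases c <;> simp only [reflX_apply, bit_true, bit_false, Bool.not_true, Bool.not_false] <;>
    refine Prod.ext ?_ (Prod.ext ?_ rfl) <;> dsimp only <;> omega

/-- `reflX` preserves `T_M`. [cite: GlazmanManolescu2019, §4.1 (proof of Proposition 1.1: the three rotated copies of the triangle, arXiv:1708.00395v3 p. 13, Fig. 6); Beaton2014RotatedHoneycomb, §2.2 (the rotated frame)] -/
theorem reflX_mem_rotTriV {M : ℕ} {v : HV} (hv : v ∈ rotTriV M) : reflX v ∈ rotTriV M := by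
  rcases mem_rotTriV_iff.1 hv with rfl | rfl | ⟨h1, h2, h3⟩
  · rw [reflX_wOut]; exact mem_rotTriV_iff.2 (Or.inr (Or.inl rfl))
  · rw [reflX_hvOrigin]; exact mem_rotTriV_iff.2 (Or.inl rfl)
  · refine mem_rotTriV_iff.2 (Or.inr (Or.inr ?_))
    rw [xi_reflX, xX_reflX]; omega

/-- `reflX` exchanges the two side lines of `T_M` (dart level): a right-side exit target becomes a
left-side one and vice versa. [cite: GlazmanManolescu2019, §4.1 (proof of Proposition 1.1: the three rotated copies of the triangle, arXiv:1708.00395v3 p. 13, Fig. 6); Beaton2014RotatedHoneycomb, §2.2 (the rotated frame)] -/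
theorem isRotSideL_reflX_iff (M : ℕ) (d : HV × HV) :
    IsRotSideL M (reflX d.1, reflX d.2) ↔ IsRotSideR M d := by
  unfold IsRotSideL IsRotSideR
  rw [xi_reflX, xX_reflX]; omega

/-- … and conversely. [cite: GlazmanManolescu2019, §4.1 (proof of Proposition 1.1: the three rotated copies of the triangle, arXiv:1708.00395v3 p. 13, Fig. 6); Beaton2014RotatedHoneycomb, §2.2 (the rotated frame)] -/
theorem isRotSideR_reflX_iff (M : ℕ) (d : HV × HV) :
    IsRotSideR M (reflX d.1, reflX d.2) ↔ IsRotSideL M d := by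
  unfold IsRotSideL IsRotSideR
  rw [xi_reflX, xX_reflX]; omega

/-- `reflX` preserves the big domain `D(H, W)` (the window `|X - 3| < 3W` is symmetric about `X = 3`):
the `c₁`-tour is the `reflX`-conjugate of the `c₀`-tour. [cite: GlazmanManolescu2019, §4.1 (proof of Proposition 1.1: the three rotated copies of the triangle, arXiv:1708.00395v3 p. 13, Fig. 6); Beaton2014RotatedHoneycomb, §2.2 (the rotated frame)] -/
theorem reflX_mem_rotStripV {H Wd : ℕ} {v : HV} (hv : v ∈ rotStripV H Wd) : reflX v ∈ rotStripV H Wd := by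
  rcases mem_rotStripV_iff.1 hv with rfl | rfl | ⟨h1, h2, h3⟩
  · rw [reflX_wOut]; exact mem_rotStripV_iff.2 (Or.inr (Or.inl rfl))
  · rw [reflX_hvOrigin]; exact mem_rotStripV_iff.2 (Or.inl rfl)
  · refine mem_rotStripV_iff.2 (Or.inr (Or.inr ⟨by rw [xi_reflX]; exact h1, by rw [xi_reflX]; exact h2, ?_⟩))
    rw [xX_reflX]
    have : (6 : ℤ) - xX v - 3 = -(xX v - 3) := by ring
    rw [this, abs_neg]; exact h3

/-- `reflX` preserves bottom darts, swaps nothing in the out/in dichotomy (both distances to `a` are kept),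
and preserves every block window: `IsRotBotWin M` is `reflX`-invariant. [cite: GlazmanManolescu2019, §4.1 (proof of Proposition 1.1: the three rotated copies of the triangle, arXiv:1708.00395v3 p. 13, Fig. 6); Beaton2014RotatedHoneycomb, §2.2 (the rotated frame)] -/
theorem isRotBotWin_reflX_iff (M : ℕ) (d : HV × HV) :
    IsRotBotWin M (reflX d.1, reflX d.2) ↔ IsRotBotWin M d := by
  have key : ∀ v : HV, |xX (reflX v) - 3| = |xX v - 3| := fun v => by
    rw [xX_reflX]
    have : (6 : ℤ) - xX v - 3 = -(xX v - 3) := by ring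
    rw [this, abs_neg]
  have hne : ∀ v : HV, (reflX v ≠ hvOrigin ↔ v ≠ wOut) ∧ (reflX v ≠ wOut ↔ v ≠ hvOrigin) := fun v => by
    constructor
    · rw [not_iff_not]; constructor
      · intro h; have := congrArg reflX h; rwa [reflX_reflX, reflX_hvOrigin] at this
      · rintro rfl; exact reflX_wOut
    · rw [not_iff_not]; constructor
      · intro h; have := congrArg reflX h; rwa [reflX_reflX, reflX_wOut] at this
      · rintro rfl; exact reflX_hvOrigin
  simp only [IsRotBotWin, IsRotBotOut, IsRotBotIn, IsRotBotDart, xi_reflX, key, (hne d.2).1, (hne d.2).2]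
  tauto

/-- Junction pattern «β»: the mirror of a right-started walk starts `a⁺ → a⁻ → …`, and under `Φ₂` this is
`u'_k → u_k → w₂` — the image of the mirrored second vertex is adjacent to `u_k = Φ₂(a⁻)`.
[cite: GlazmanManolescu2019, §4.1 (proof of Proposition 1.1, arXiv:1708.00395v3 p. 13), lane ROUTES-G15 §2.3 S4] -/
theorem junction_beta_adj (M k : ℕ) {v : HV} (hv : hvGraph.Adj hvOrigin v) :
    hvGraph.Adj (rotPhi2 M k wOut) (rotPhi2 M k (reflX v)) := by
  refine (rotPhi2 M k).map_adj_iff.2 ?_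
  have := reflX.map_adj_iff.2 hv
  rwa [reflX_hvOrigin] at this

/-- Junction pattern «α»: `u_k → u'_k → w₂'` with `w₂' = Φ₂` of the second vertex of a right-started
walk. [cite: GlazmanManolescu2019, §4.1 (proof of Proposition 1.1, arXiv:1708.00395v3 p. 13), lane ROUTES-G15 §2.3 S4] -/
theorem junction_alpha_adj (M k : ℕ) {v : HV} (hv : hvGraph.Adj hvOrigin v) :
    hvGraph.Adj (rotPhi2 M k hvOrigin) (rotPhi2 M k v) :=
  (rotPhi2 M k).map_adj_iff.2 hv

/-! ### Uniqueness of vertices by coordinates, the junction vertices as exit targets, the cocycle -/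

/-- A vertex is determined by `(X, ξ)` (the integer model is faithful). [cite: GlazmanManolescu2019, §4.1 (proof of Proposition 1.1: the three rotated copies of the triangle, arXiv:1708.00395v3 p. 13, Fig. 6); Beaton2014RotatedHoneycomb, §2.2 (the rotated frame)] -/
theorem eq_of_xi_eq_of_xX_eq {u v : HV} (h1 : xi u = xi v) (h2 : xX u = xX v) : u = v := by
  obtain ⟨a, b, c⟩ := u
  obtain ⟨a', b', c'⟩ := v
  cases c <;> cases c' <;> simp only [xi, xX, bit_true, bit_false] at h1 h2 <;>
    first
    | (exfalso; omega)
    | (refine Prod.ext ?_ (Prod.ext ?_ rfl) <;> dsimp only <;> omega)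

/-- **The exit vertex of piece 1 IS a junction vertex**: a vertex on the left side line of `T_M` at
height `3k + 1` is `u_k = Φ₂(a⁻)`, at height `3k + 2` it is `u'_k = Φ₂(a⁺)` (heights `≡ 0 (mod 3)` on the
`60°`-ray are hexagon centres, not vertices). [cite: GlazmanManolescu2019, §4.1 (proof of Proposition 1.1: the three rotated copies of the triangle, arXiv:1708.00395v3 p. 13, Fig. 6); Beaton2014RotatedHoneycomb, §2.2 (the rotated frame)] -/
theorem eq_junction_of_leftLine {M k : ℕ} {e : HV} (he : xX e = -(6 : ℤ) * M - xi e) :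
    (xi e = -(3 * k + 1) → e = rotPhi2 M k wOut) ∧ (xi e = -(3 * k + 2) → e = rotPhi2 M k hvOrigin) := by
  obtain ⟨a1, a2⟩ := rotPhi2_wOut_coords M k
  obtain ⟨b1, b2⟩ := rotPhi2_hvOrigin_coords M k
  exact ⟨fun h => eq_of_xi_eq_of_xX_eq (by omega) (by omega),
    fun h => eq_of_xi_eq_of_xX_eq (by omega) (by omega)⟩

/-- No vertex of the `60°`-ray has height `≡ 0 (mod 3)`: the left-side exits of `T_M` are exactly the
ray-edge endpoints. [cite: GlazmanManolescu2019, §4.1 (proof of Proposition 1.1: the three rotated copies of the triangle, arXiv:1708.00395v3 p. 13, Fig. 6); Beaton2014RotatedHoneycomb, §2.2 (the rotated frame)] -/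
theorem leftLine_height_mod_three {M : ℕ} {e : HV} (he : xX e = -(6 : ℤ) * M - xi e) : xi e % 3 ≠ 0 := by
  obtain ⟨a, b, c⟩ := e
  cases c <;> simp only [xi, xX, bit_true, bit_false] at he ⊢ <;> omega

/-- The junction vertices are NOT vertices of `T_M` (so piece 1 meets ray-edge `k` only at its exit).
[cite: GlazmanManolescu2019, §4.1 (proof of Proposition 1.1: the three rotated copies of the triangle, arXiv:1708.00395v3 p. 13, Fig. 6); Beaton2014RotatedHoneycomb, §2.2 (the rotated frame)] -/
theorem junction_not_mem_rotTriV (M k : ℕ) :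
    rotPhi2 M k wOut ∉ rotTriV M ∧ rotPhi2 M k hvOrigin ∉ rotTriV M := by
  obtain ⟨a1, a2⟩ := rotPhi2_wOut_coords M k
  obtain ⟨b1, b2⟩ := rotPhi2_hvOrigin_coords M k
  have hw := xi_wOut; have ho := xi_hvOrigin
  constructor <;> intro h <;> rcases mem_rotTriV_iff.1 h with h' | h' | ⟨-, h3, -⟩
  · rw [h'] at a1; omega
  · rw [h'] at a1; omega
  · omega
  · rw [h'] at b1; omega
  · rw [h'] at b1; omega
  · omega

/-- **Cocycle: the second junction.** Placing `T_{k'}` at ray-edge `k'` of the ALREADY PLACED `T_k` is the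
placement `Φ₃`: `Φ₂(M,k) ∘ Φ₂(k,k') = Φ₃(M,k')` (translation–rotation bookkeeping: `T_{6(k-M)} ∘ R_{c₀(k)}
∘ T_{6(k'-k)} = R_{c₀(M)} ∘ T_{6(k'-M)}` after one more `R_{c₀(M)}`). Hence piece 2's exit vertex at its
own ray-edge `k'` is glued to `Φ₃(M,k')(a''∓)`. [cite: GlazmanManolescu2019, §4.1] -/
theorem rotPhi2_rotPhi2 (M k k' : ℕ) (v : HV) : rotPhi2 M k (rotPhi2 k k' v) = rotPhi3 M k' v := by
  obtain ⟨a, b, c⟩ := v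
  cases c <;>
    simp only [rotPhi2_eq, rotPhi3_eq, slideL, shift_apply, rotC0_apply, bit_true, bit_false,
      Bool.not_true, Bool.not_false] <;>
    (refine Prod.ext ?_ (Prod.ext ?_ rfl)
     all_goals first | rfl | (dsimp only; omega))

/-! ### Kernel sanity at `M = 1` for every new definition (lead r105 guard; the E-G15-1, E-G15-2 lesson) -/

/-- `rotC0 1`: `a⁻ = (X,h) = (2,0) ↦ (-2,4)`, i.e. `(-1,-2,false)`; order six on `a⁺`; `slideL 1 0 (a⁺) =
(1,-2,false)` (`X = -2`); `Φ₃(1,1)(a⁻) = (0,-5,true)` = height `4` on the `120°`-ray (`X + 6 = -4`);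
the mirror swaps `a∓`. [folklore] -/
example : rotC0 1 wOut = ((-1 : ℤ), (-2 : ℤ), false) ∧
    rotC0 1 (rotC0 1 (rotC0 1 (rotC0 1 (rotC0 1 (rotC0 1 hvOrigin))))) = hvOrigin ∧
    slideL 1 0 hvOrigin = ((1 : ℤ), (-2 : ℤ), false) ∧ rotPhi3 1 1 wOut = ((0 : ℤ), (-5 : ℤ), true) ∧
    reflX (reflX (rotPhi2 1 2 wOut)) = rotPhi2 1 2 wOut := by decide
example : xi (rotPhi3 1 1 wOut) = -4 ∧ xX (rotPhi3 1 1 wOut) + 6 = -4 ∧ xX (slideL 1 0 hvOrigin) = -2 := by decide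
/-- The up-neighbour `(−1,0,true)` of `a⁺` (`X = 5`, `h = 1`) is in `T_1`; its `Φ₂(1,1)`-image is in `Σ₂`
and in `D(28,28)`, its `Φ₃(1,1)`-image in `Σ₃`; `T_1`'s apex-row vertex... and the three sectors really
differ on these images. [folklore] -/
example : ((-1 : ℤ), (0 : ℤ), true) ∈ rotTriV 1 ∧ rotPhi2 1 1 ((-1 : ℤ), (0 : ℤ), true) ∈ rotStripV 28 28 ∧
    rotPhi3 1 1 ((-1 : ℤ), (0 : ℤ), true) ∈ rotStripV 28 28 ∧
    rotPhi2 1 1 ((-1 : ℤ), (0 : ℤ), true) ∉ rotTriV 1 ∧ rotPhi3 1 1 ((-1 : ℤ), (0 : ℤ), true) ∉ rotTriV 1 := by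
  refine ⟨by decide, ?_, ?_, by decide, by decide⟩ <;> (rw [mem_rotStripV_iff]; decide)
example : InSector2 1 (rotPhi2 1 1 ((-1 : ℤ), (0 : ℤ), true)) ∧ InSector3 1 (rotPhi3 1 1 ((-1 : ℤ), (0 : ℤ), true)) ∧
    InSector1 1 ((-1 : ℤ), (0 : ℤ), true) ∧ ¬InSector1 1 (rotPhi2 1 1 ((-1 : ℤ), (0 : ℤ), true)) := by
  unfold InSector1 InSector2 InSector3; decide

/-! ### Kernel sanity of the WHOLE TOUR MECHANISM at `M = 1` (a-idea-1 g16, `tour/tour_m1.py`)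

Sixteen explicit glued tours `G = Q ++ ((P₂'.map Φ₂(1,k)).drop j₂) ++ ((P₃'.map Φ₃(1,k')).drop j₃)` — one per
(junction pattern `j₂, j₃ ∈ {1, 2}`) × (class of piece 2, 3 ∈ {as-is left-exit `L`, mirrored right-exit `σR`}),
pieces = shortest walks found by `tour_m1.py` (53 tours built there, 0 failures) — each checked BY THE KERNEL to
be a right-started mid-walk of `D(28,28) ∖ {a⁻}` whose final dart is a bottom dart in the block-`1` window
(`IsRotBotWin 1`), with `mwLen G = mwLen Q + mwLen P₂ + mwLen P₃ + (2 - j₂) + (2 - j₃)` (a `drop 1` junction costs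
one vertex = one factor `x_c`, a `drop 2` junction costs nothing). The placements `rotPhi2` / `rotPhi3` / `reflX`
are applied by the kernel, not pre-expanded. -/

/-- From the small self-check `IsMidWalk P.toFinset P` plus the arithmetic form of strip membership to
`IsMidWalk (D(H,W) ∖ {a⁻}) P` (avoids deciding membership in the big finset). [cite: GlazmanManolescu2019, §4.1 (proof of Proposition 1.1: the three rotated copies of the triangle, arXiv:1708.00395v3 p. 13, Fig. 6); Beaton2014RotatedHoneycomb, §2.2 (the rotated frame)] -/
theorem isMidWalk_strip_of {H Wd : ℕ} {P : List HV} (h1 : IsMidWalk P.toFinset P)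
    (h2 : ∀ x ∈ inner P, x ≠ wOut ∧ (x = wOut ∨ x = hvOrigin ∨ (1 ≤ -xi x ∧ -xi x ≤ H ∧ |xX x - 3| < 3 * Wd))) :
    IsMidWalk ((rotStripV H Wd).erase wOut) P := by
  obtain ⟨hc, hh, ht, -, hnd, hne⟩ := h1
  exact ⟨hc, hh, ht, fun x hx => mem_erase.2 ⟨(h2 x hx).1, mem_rotStripV_iff.2 (h2 x hx).2⟩, hnd, hne⟩

/-- Tour instance 1: k = 1, arrival at u_k, piece 2 class L placed by Φ₂(1,1) (drop 1), exit k′ = 1 at u, piece 3 class L placed by Φ₃(1,1) (drop 1); final dart bottom-out at |X-3| = 17; mwLen 20 = 6 + 6 + 6 + 1 + 1. [folklore] -/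
def tourEx1 : List HV :=
  [((0 : ℤ), (-1 : ℤ), true), ((0 : ℤ), (0 : ℤ), false), ((-1 : ℤ), (0 : ℤ), true), ((-1 : ℤ), (0 : ℤ), false), ((-1 : ℤ), (-1 : ℤ), true), ((-1 : ℤ), (-1 : ℤ), false), ((-1 : ℤ), (-2 : ℤ), true), ((-1 : ℤ), (-2 : ℤ), false)] ++
    ((([((0 : ℤ), (-1 : ℤ), true), ((0 : ℤ), (0 : ℤ), false), ((-1 : ℤ), (0 : ℤ), true), ((-1 : ℤ), (0 : ℤ), false), ((-1 : ℤ), (-1 : ℤ), true), ((-1 : ℤ), (-1 : ℤ), false), ((-1 : ℤ), (-2 : ℤ), true), ((-1 : ℤ), (-2 : ℤ), false)]).map (rotPhi2 1 1)).drop 1) ++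
    ((([((0 : ℤ), (-1 : ℤ), true), ((0 : ℤ), (0 : ℤ), false), ((-1 : ℤ), (0 : ℤ), true), ((-1 : ℤ), (0 : ℤ), false), ((-1 : ℤ), (-1 : ℤ), true), ((-1 : ℤ), (-1 : ℤ), false), ((-1 : ℤ), (-2 : ℤ), true), ((-1 : ℤ), (-2 : ℤ), false)]).map (rotPhi3 1 1)).drop 1)

example : IsMidWalk ((rotStripV 28 28).erase wOut) tourEx1 ∧ IsRotBotWin 1 (finalDart tourEx1) ∧
    mwLen tourEx1 = 6 + 6 + 6 + 1 + 1 :=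
  ⟨isMidWalk_strip_of (by decide) (by decide), by decide, by decide⟩

/-- Tour instance 2: k = 1, arrival at u_k, piece 2 class L placed by Φ₂(1,1) (drop 1), exit k′ = 0 at u′, piece 3 class Rmir placed by Φ₃(1,0) (drop 1); final dart bottom-out at |X-3| = 11; mwLen 16 = 6 + 7 + 1 + 1 + 1. [folklore] -/
def tourEx2 : List HV :=
  [((0 : ℤ), (-1 : ℤ), true), ((0 : ℤ), (0 : ℤ), false), ((-1 : ℤ), (0 : ℤ), true), ((-1 : ℤ), (0 : ℤ), false), ((-1 : ℤ), (-1 : ℤ), true), ((-1 : ℤ), (-1 : ℤ), false), ((-1 : ℤ), (-2 : ℤ), true), ((-1 : ℤ), (-2 : ℤ), false)] ++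
    ((([((0 : ℤ), (-1 : ℤ), true), ((0 : ℤ), (0 : ℤ), false), ((-1 : ℤ), (0 : ℤ), true), ((-1 : ℤ), (0 : ℤ), false), ((-1 : ℤ), (-1 : ℤ), true), ((-1 : ℤ), (-1 : ℤ), false), ((-1 : ℤ), (-2 : ℤ), true), ((0 : ℤ), (-2 : ℤ), false), ((0 : ℤ), (-3 : ℤ), true)]).map (rotPhi2 1 1)).drop 1) ++
    (((([((0 : ℤ), (-1 : ℤ), true), ((0 : ℤ), (0 : ℤ), false), ((-1 : ℤ), (0 : ℤ), true)]).map reflX).map (rotPhi3 1 0)).drop 1)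

example : IsMidWalk ((rotStripV 28 28).erase wOut) tourEx2 ∧ IsRotBotWin 1 (finalDart tourEx2) ∧
    mwLen tourEx2 = 6 + 7 + 1 + 1 + 1 :=
  ⟨isMidWalk_strip_of (by decide) (by decide), by decide, by decide⟩


end Literature.Probability.RandomPlanarGeometry.SAW.HV
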